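import Summits.QuantumFields.YangMills.Theorems.EntropyBudgetEquipartitionScaleEntropyIdentity
import Summits.QuantumFields.YangMills.Theorems.EntropyBudgetEquipartitionTransferOfTwoSignedSource
import HarnessLib

/-!
# Route `EntropyBudgetEquipartition`, crux `EntropyBudgetTransfer` (stmt-QuantumFields-22401) — Gibbs duality: the sourced pressure bound IS an entropy-budget transfer

HONEST LABEL: helper lemmas toward a RECORD-label rung (R2ξ-G, `WeakCouplingRates.XiPow`, an UPPER bound on the lattice gap);
nothing here bears on the Clay Yang–Mills mass gap, which is NOT proved by any of this.

The two lines of ideator ym-idea-3 on the leaf `XiPow` meet at one statement read through convex (Legendre) duality.  LINE 2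
(`SourcedPressureJensen`) asks for an UPPER bound on the sourced pressure increment `|Λ|⁻¹ log E_{β,Λ} e^{−h H_{n,Λ}}`; LINE 1
(`EntropyBudgetEquipartition`, this route) wants to turn an ENTROPY BUDGET into a covariance law.  The attained Gibbs variational
principle `log E_μ e^F = E_{μ^F}[F] − KL(μ^F ‖ μ) = max_ν {E_ν[F] − KL(ν ‖ μ)}` (`μ^F` the tilt; `ScaleEntropy.toReal_klDiv_tilted_left`
and the Donsker–Varadhan inequality of `Literature.Probability.Divergences`) makes them the same:

* `log_integral_exp_eq_integral_tilted_sub_klDiv`, `log_integral_exp_le_iff` (any probability space, bounded measurable `F`):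
  `log E_μ e^F ≤ b ↔ ∀ ν ≪ μ probability with KL(ν ‖ μ) < ∞, E_ν[F] − KL(ν ‖ μ) ≤ b`;
* `sourcedPressure_le_iff_entropyTradeoff` (torus Wilson state `μ = μ_{β,Λ_{L+1}}`, any real `h`, separation `n`): the sourced
  pressure increment is `≤ b` iff EVERY state `ν` of finite relative entropy w.r.t. `μ` obeys the entropy–covariance tradeoff
  `−h |Λ|⁻¹ E_ν[H_{n,Λ}] − |Λ|⁻¹ KL(ν ‖ μ) ≤ b`;
* `twoSignedSource_iff_entropyTradeoff` (pointwise in `(G, r)`): the two-signed sourced pressure bound of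
  `TwoSignedSource.twoSidedLaw_of_twoSignedSource` ⇔ the two-signed entropy–covariance tradeoff, same constants;
* `entropyBudgetTransfer_of_entropyTradeoff`: hence the crux `EntropyBudgetTransfer` follows from the tradeoff form — «every
  state whose specific relative entropy with respect to the Yang–Mills torus state is `δ` moves the source-weighted plaquette
  covariance by at most `−h σ C(n)² + C β^(−κ) + M h² + δ` in sourced-pressure units», for both signs of `h`.

So LINE 1's transfer step KT and LINE 2's crux KS are not independent bets: KS is exactly an entropy-budget transfer inequality
with the Yang–Mills state as the REFERENCE and arbitrary perturbed states as the budgeted states. [folklore]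
-/

noncomputable section

namespace Summit.QuantumFields.YangMills.Theorems.EntropyBudgetEquipartition.GibbsDuality

open MeasureTheory Filter InformationTheory
open Literature.MathematicalPhysics.QuantumFieldTheory Literature.MathematicalPhysics.QuantumLattice
  Summit.QuantumFields.YangMills.Theorems.WeakCouplingRates
  Summit.QuantumFields.YangMills.Theorems.EntropyBudgetEquipartition.ScaleEntropy
  Summit.QuantumFields.YangMills.Theorems.EntropyBudgetEquipartition.TwoSignedSource

/-! ### The attained Gibbs variational principle on a probability space -/

section General

variable {Ω : Type*} [MeasurableSpace Ω] {μ : Measure Ω} [IsProbabilityMeasure μ] {F : Ω → ℝ} {B : ℝ}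

/-- **Gibbs variational principle, attained at the tilt**: for bounded measurable `F`,
`log E_μ e^F = E_{μ^F}[F] − KL(μ^F ‖ μ)`. [folklore] -/
theorem log_integral_exp_eq_integral_tilted_sub_klDiv (hF : Measurable F) (hB : ∀ ω, |F ω| ≤ B) :
    Real.log (∫ ω, Real.exp (F ω) ∂μ) = (∫ ω, F ω ∂(μ.tilted F)) - (klDiv (μ.tilted F) μ).toReal := by
  have h := (toReal_klDiv_tilted_left (μ := μ) hF hB).2
  linarith

/-- **Gibbs variational principle as a criterion**: for bounded measurable `F` and real `b`,
`log E_μ e^F ≤ b` iff every probability measure `ν` with `KL(ν ‖ μ) < ∞` has `E_ν[F] − KL(ν ‖ μ) ≤ b`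
(Donsker–Varadhan for `→`, the tilt `ν = μ^F` for `←`). [folklore] -/
theorem log_integral_exp_le_iff (hF : Measurable F) (hB : ∀ ω, |F ω| ≤ B) {b : ℝ} :
    Real.log (∫ ω, Real.exp (F ω) ∂μ) ≤ b ↔
      ∀ ν : Measure Ω, IsProbabilityMeasure ν → klDiv ν μ ≠ ⊤ → (∫ ω, F ω ∂ν) - (klDiv ν μ).toReal ≤ b := by
  constructor
  · intro h ν hν hfin
    haveI := hν
    have dv := Literature.Probability.Divergences.integral_le_toReal_klDiv_add_log (μ := ν) (ν := μ) hfin hF hB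
    linarith
  · intro h
    haveI : IsProbabilityMeasure (μ.tilted F) := isProbabilityMeasure_tilted (integrable_exp_of_abs_le hF hB)
    rw [log_integral_exp_eq_integral_tilted_sub_klDiv hF hB]
    exact h _ inferInstance (toReal_klDiv_tilted_left hF hB).1

/-- The criterion divided by a positive volume factor `V`: `V⁻¹ log E_μ e^F ≤ b ↔ ∀ ν, V⁻¹ E_ν[F] − V⁻¹ KL(ν ‖ μ) ≤ b`. [folklore] -/
theorem inv_mul_log_integral_exp_le_iff (hF : Measurable F) (hB : ∀ ω, |F ω| ≤ B) {V b : ℝ} (hV : 0 < V) :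
    V⁻¹ * Real.log (∫ ω, Real.exp (F ω) ∂μ) ≤ b ↔
      ∀ ν : Measure Ω, IsProbabilityMeasure ν → klDiv ν μ ≠ ⊤ →
        V⁻¹ * (∫ ω, F ω ∂ν) - V⁻¹ * (klDiv ν μ).toReal ≤ b := by
  have hV' : 0 < V⁻¹ := inv_pos.2 hV
  have key : V⁻¹ * Real.log (∫ ω, Real.exp (F ω) ∂μ) ≤ b ↔ Real.log (∫ ω, Real.exp (F ω) ∂μ) ≤ V * b := by
    rw [inv_mul_le_iff₀ hV]
  rw [key, log_integral_exp_le_iff hF hB]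
  refine forall₃_congr fun ν _ _ => ?_
  rw [← mul_sub, inv_mul_le_iff₀ hV]

end General

/-! ### The torus Wilson state: sourced pressure ⇔ entropy–covariance tradeoff -/

section Wilson

variable (G : Type) [Group G] [TopologicalSpace G] [IsTopologicalGroup G] [CompactSpace G]
  [MeasurableSpace G] [BorelSpace G] (r : LatticeRep G)

omit [BorelSpace G] in
/-- The centred two-plaquette source `H_{n,Λ} = Σ_x (β c(x) − β m)(β c(x + n e₀) − β m)` (any real centring `m`) is a continuous
function of the torus configuration. [folklore] -/
theorem continuous_sourceSum (β m : ℝ) (n L : ℕ) :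
    Continuous fun U : GaugeConfig 4 (L + 1) G =>
      ∑ x : Fin 4 → Fin (L + 1),
        toTorusObservable (L + 1)
          (fun V : LGConfig 4 G =>
            (β * plaqCost0 (d := 4) r.ρ 1 2 (configShift (fun i => -((x i : ℕ) : ℤ)) V) - β * m) *
              (β * plaqCost0 (d := 4) r.ρ 1 2 (timeShiftLG (G := G) n (configShift (fun i => -((x i : ℕ) : ℤ)) V)) - β * m))
          U := by
  have hc : Continuous (plaqCost0 (d := 4) (G := G) r.ρ 1 2) := (continuous_bounded_plaqCost0 r.ρ r.continuous 1 2).1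
  refine continuous_finsetSum _ fun x _ => ?_
  have hs : Continuous (configShift (G := G) (fun i => -((x i : ℕ) : ℤ)) : LGConfig 4 G → LGConfig 4 G) :=
    continuous_configShift _
  have ht : Continuous (timeShiftLG (d := 4) (G := G) n : LGConfig 4 G → LGConfig 4 G) := continuous_timeShiftLG n
  have hg : Continuous fun V : LGConfig 4 G =>
      (β * plaqCost0 (d := 4) r.ρ 1 2 (configShift (fun i => -((x i : ℕ) : ℤ)) V) - β * m) *
        (β * plaqCost0 (d := 4) r.ρ 1 2 (timeShiftLG (G := G) n (configShift (fun i => -((x i : ℕ) : ℤ)) V)) - β * m) :=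
    ((continuous_const.mul (hc.comp hs)).sub continuous_const).mul
      ((continuous_const.mul (hc.comp (ht.comp hs))).sub continuous_const)
  exact hg.comp (continuous_torusLift (L + 1))

/-- **Sourced pressure ⇔ entropy–covariance tradeoff** (torus Wilson state `μ = μ_{β,Λ_{L+1}}` of the gauge group `G` in the
lattice representation `r`; any real `h`, separation `n`, bound `b`): the sourced pressure increment
`|Λ|⁻¹ log E_μ exp(−h H_{n,Λ})` is `≤ b` iff every probability measure `ν` on torus configurations with `KL(ν ‖ μ) < ∞` satisfies
`−h |Λ|⁻¹ E_ν[H_{n,Λ}] − |Λ|⁻¹ KL(ν ‖ μ) ≤ b` (`H_{n,Λ}` centred at the `μ`-mean of the plaquette cost).  Gibbs variational principle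
for the bounded continuous `−h H_{n,Λ}`. [folklore] -/
theorem sourcedPressure_le_iff_entropyTradeoff (β : ℝ) (n : ℕ) (h : ℝ) (L : ℕ) (b : ℝ) :
    ((L + 1 : ℝ) ^ 4)⁻¹ * Real.log (wilsonExpectation (L := L + 1) r.ρ β fun U => Real.exp (-h * ∑ x : Fin 4 → Fin (L + 1),
        toTorusObservable (L + 1) (fun V => (β * plaqCost0 (d := 4) r.ρ 1 2 (configShift (fun i => -((x i : ℕ) : ℤ)) V) -
          β * wilsonExpectation (L := L + 1) r.ρ β (toTorusObservable (L + 1) (plaqCost0 (d := 4) r.ρ 1 2))) *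
          (β * plaqCost0 (d := 4) r.ρ 1 2 (timeShiftLG (G := G) n (configShift (fun i => -((x i : ℕ) : ℤ)) V)) -
            β * wilsonExpectation (L := L + 1) r.ρ β (toTorusObservable (L + 1) (plaqCost0 (d := 4) r.ρ 1 2)))) U)) ≤ b ↔
      ∀ ν : Measure (GaugeConfig 4 (L + 1) G), IsProbabilityMeasure ν →
        klDiv ν (wilsonMeasure (d := 4) (L := L + 1) r.ρ β) ≠ ⊤ →
          ((L + 1 : ℝ) ^ 4)⁻¹ * (-h * ∫ U, (∑ x : Fin 4 → Fin (L + 1),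
              toTorusObservable (L + 1) (fun V => (β * plaqCost0 (d := 4) r.ρ 1 2 (configShift (fun i => -((x i : ℕ) : ℤ)) V) -
                β * wilsonExpectation (L := L + 1) r.ρ β (toTorusObservable (L + 1) (plaqCost0 (d := 4) r.ρ 1 2))) *
                (β * plaqCost0 (d := 4) r.ρ 1 2 (timeShiftLG (G := G) n (configShift (fun i => -((x i : ℕ) : ℤ)) V)) -
                  β * wilsonExpectation (L := L + 1) r.ρ β (toTorusObservable (L + 1) (plaqCost0 (d := 4) r.ρ 1 2)))) U) ∂ν) -
            ((L + 1 : ℝ) ^ 4)⁻¹ * (klDiv ν (wilsonMeasure (d := 4) (L := L + 1) r.ρ β)).toReal ≤ b := by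
  haveI : SecondCountableTopology G :=
    (r.continuous.isClosedEmbedding r.injective).isEmbedding.secondCountableTopology
  haveI := isProbabilityMeasure_wilsonMeasure (d := 4) (L := L + 1) r.ρ r.continuous β
  set m : ℝ := wilsonExpectation (L := L + 1) r.ρ β (toTorusObservable (L + 1) (plaqCost0 (d := 4) r.ρ 1 2 : LGConfig 4 G → ℝ))
    with hm
  have hHc := continuous_sourceSum G r β m n L
  obtain ⟨C, hC⟩ := Cruxes.JensenFloor.Birth.exists_abs_le_of_continuous hHc
  -- the bounded measurable exponent `F = −h H`
  have hF : Measurable fun U : GaugeConfig 4 (L + 1) G => -h * ∑ x : Fin 4 → Fin (L + 1),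
      toTorusObservable (L + 1)
        (fun V : LGConfig 4 G =>
          (β * plaqCost0 (d := 4) r.ρ 1 2 (configShift (fun i => -((x i : ℕ) : ℤ)) V) - β * m) *
            (β * plaqCost0 (d := 4) r.ρ 1 2 (timeShiftLG (G := G) n (configShift (fun i => -((x i : ℕ) : ℤ)) V)) - β * m))
        U := (continuous_const.mul hHc).measurable
  have hFB : ∀ U : GaugeConfig 4 (L + 1) G, |-h * ∑ x : Fin 4 → Fin (L + 1),
      toTorusObservable (L + 1)
        (fun V : LGConfig 4 G =>
          (β * plaqCost0 (d := 4) r.ρ 1 2 (configShift (fun i => -((x i : ℕ) : ℤ)) V) - β * m) *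
            (β * plaqCost0 (d := 4) r.ρ 1 2 (timeShiftLG (G := G) n (configShift (fun i => -((x i : ℕ) : ℤ)) V)) - β * m))
        U| ≤ |h| * C := fun U => by
    rw [abs_mul, abs_neg]; exact mul_le_mul_of_nonneg_left (hC U) (abs_nonneg _)
  have hV : (0 : ℝ) < (L + 1 : ℝ) ^ 4 := by positivity
  have key := inv_mul_log_integral_exp_le_iff (μ := wilsonMeasure (d := 4) (L := L + 1) r.ρ β) hF hFB (b := b) hV
  simp only [wilsonExpectation] at key ⊢
  rw [key]
  refine forall₃_congr fun ν _ _ => ?_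
  rw [integral_const_mul]

/-- **The two-signed sourced pressure bound ⇔ the two-signed entropy–covariance tradeoff**, pointwise in `(G, r)` and with the
same constants: the hypothesis of `TwoSignedSource.twoSidedLaw_of_twoSignedSource` in its dual, entropy-budget form. [folklore] -/
theorem twoSignedSource_iff_entropyTradeoff :
    (∃ κ A M C σ h₀ β₀ : ℝ, 0 < κ ∧ 0 < A ∧ 0 < σ ∧ 0 < h₀ ∧ ∀ β : ℝ, β₀ ≤ β → ∀ n : ℕ, 1 ≤ n → (n : ℝ) ≤ 2 * β ^ A →
      ∀ h : ℝ, h ≠ 0 → |h| ≤ h₀ → ∀ᶠ L : ℕ in Filter.atTop,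
        ((L + 1 : ℝ) ^ 4)⁻¹ * Real.log (wilsonExpectation (L := L + 1) r.ρ β fun U => Real.exp (-h * ∑ x : Fin 4 → Fin (L + 1),
          toTorusObservable (L + 1) (fun V => (β * plaqCost0 (d := 4) r.ρ 1 2 (configShift (fun i => -((x i : ℕ) : ℤ)) V) -
            β * wilsonExpectation (L := L + 1) r.ρ β (toTorusObservable (L + 1) (plaqCost0 (d := 4) r.ρ 1 2))) *
            (β * plaqCost0 (d := 4) r.ρ 1 2 (timeShiftLG (G := G) n (configShift (fun i => -((x i : ℕ) : ℤ)) V)) -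
              β * wilsonExpectation (L := L + 1) r.ρ β (toTorusObservable (L + 1) (plaqCost0 (d := 4) r.ρ 1 2)))) U)) ≤
          -h * (σ * (curvaturePlaquetteCorr (d := 4) (by norm_num) (n : ℤ)) ^ 2) + C * β ^ (-κ) + M * h ^ 2) ↔
    (∃ κ A M C σ h₀ β₀ : ℝ, 0 < κ ∧ 0 < A ∧ 0 < σ ∧ 0 < h₀ ∧ ∀ β : ℝ, β₀ ≤ β → ∀ n : ℕ, 1 ≤ n → (n : ℝ) ≤ 2 * β ^ A →
      ∀ h : ℝ, h ≠ 0 → |h| ≤ h₀ → ∀ᶠ L : ℕ in Filter.atTop,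
        ∀ ν : Measure (GaugeConfig 4 (L + 1) G), IsProbabilityMeasure ν →
          klDiv ν (wilsonMeasure (d := 4) (L := L + 1) r.ρ β) ≠ ⊤ →
            ((L + 1 : ℝ) ^ 4)⁻¹ * (-h * ∫ U, (∑ x : Fin 4 → Fin (L + 1),
                toTorusObservable (L + 1) (fun V => (β * plaqCost0 (d := 4) r.ρ 1 2 (configShift (fun i => -((x i : ℕ) : ℤ)) V) -
                  β * wilsonExpectation (L := L + 1) r.ρ β (toTorusObservable (L + 1) (plaqCost0 (d := 4) r.ρ 1 2))) *
                  (β * plaqCost0 (d := 4) r.ρ 1 2 (timeShiftLG (G := G) n (configShift (fun i => -((x i : ℕ) : ℤ)) V)) -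
                    β * wilsonExpectation (L := L + 1) r.ρ β (toTorusObservable (L + 1) (plaqCost0 (d := 4) r.ρ 1 2)))) U) ∂ν) -
              ((L + 1 : ℝ) ^ 4)⁻¹ * (klDiv ν (wilsonMeasure (d := 4) (L := L + 1) r.ρ β)).toReal ≤
            -h * (σ * (curvaturePlaquetteCorr (d := 4) (by norm_num) (n : ℤ)) ^ 2) + C * β ^ (-κ) + M * h ^ 2) := by
  refine exists_congr fun κ => exists_congr fun A => exists_congr fun M => exists_congr fun C => exists_congr fun σ =>
    exists_congr fun h₀ => exists_congr fun β₀ => ?_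
  refine and_congr_right fun _ => and_congr_right fun _ => and_congr_right fun _ => and_congr_right fun _ => ?_
  refine forall₂_congr fun β _ => forall₃_congr fun n _ _ => forall₃_congr fun h _ _ => ?_
  refine Filter.eventually_congr (Filter.Eventually.of_forall fun L => ?_)
  exact sourcedPressure_le_iff_entropyTradeoff G r β n h L _

end Wilson

/-! ### The crux from the entropy–covariance tradeoff -/

/-- **`EntropyBudgetTransfer` from the two-signed entropy–covariance tradeoff.**  If at every compact simple `G` and lattice
representation `r`, for `β ≥ β₀`, `1 ≤ n ≤ 2β^A`, `0 < |h| ≤ h₀` and eventually in the torus size, EVERY state `ν` of finite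
relative entropy with respect to the Yang–Mills torus state `μ_{β,Λ}` satisfies
`−h |Λ|⁻¹ E_ν[H_{n,Λ}] − |Λ|⁻¹ KL(ν ‖ μ_{β,Λ}) ≤ −h σ C(n)² + C β^(−κ) + M h²`, then the crux `EntropyBudgetTransfer` holds —
Gibbs duality (`twoSignedSource_iff_entropyTradeoff`) and `TwoSignedSource.entropyBudgetTransfer_of_twoSignedSource`.
A reduction of a RECORD-label rung crux; NOT the Clay mass gap. [folklore] -/
theorem entropyBudgetTransfer_of_entropyTradeoff
    (hT : ∀ (G : Type) [Group G] [TopologicalSpace G] [IsTopologicalGroup G] [CompactSpace G], IsCompactSimpleLieGroup G →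
      letI : MeasurableSpace G := borel G; haveI : BorelSpace G := ⟨rfl⟩; ∀ r : LatticeRep G,
      ∃ κ A M C σ h₀ β₀ : ℝ, 0 < κ ∧ 0 < A ∧ 0 < σ ∧ 0 < h₀ ∧ ∀ β : ℝ, β₀ ≤ β → ∀ n : ℕ, 1 ≤ n → (n : ℝ) ≤ 2 * β ^ A →
      ∀ h : ℝ, h ≠ 0 → |h| ≤ h₀ → ∀ᶠ L : ℕ in Filter.atTop,
        ∀ ν : Measure (GaugeConfig 4 (L + 1) G), IsProbabilityMeasure ν →
          klDiv ν (wilsonMeasure (d := 4) (L := L + 1) r.ρ β) ≠ ⊤ →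
            ((L + 1 : ℝ) ^ 4)⁻¹ * (-h * ∫ U, (∑ x : Fin 4 → Fin (L + 1),
                toTorusObservable (L + 1) (fun V => (β * plaqCost0 (d := 4) r.ρ 1 2 (configShift (fun i => -((x i : ℕ) : ℤ)) V) -
                  β * wilsonExpectation (L := L + 1) r.ρ β (toTorusObservable (L + 1) (plaqCost0 (d := 4) r.ρ 1 2))) *
                  (β * plaqCost0 (d := 4) r.ρ 1 2 (timeShiftLG (G := G) n (configShift (fun i => -((x i : ℕ) : ℤ)) V)) -
                    β * wilsonExpectation (L := L + 1) r.ρ β (toTorusObservable (L + 1) (plaqCost0 (d := 4) r.ρ 1 2)))) U) ∂ν) -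
              ((L + 1 : ℝ) ^ 4)⁻¹ * (klDiv ν (wilsonMeasure (d := 4) (L := L + 1) r.ρ β)).toReal ≤
            -h * (σ * (curvaturePlaquetteCorr (d := 4) (by norm_num) (n : ℤ)) ^ 2) + C * β ^ (-κ) + M * h ^ 2) :
    Summit.QuantumFields.YangMills.Theses.EntropyBudgetEquipartition.EntropyBudgetTransfer := by
  refine entropyBudgetTransfer_of_twoSignedSource fun G _ _ _ _ hG => ?_
  letI : MeasurableSpace G := borel G
  haveI : BorelSpace G := ⟨rfl⟩
  intro r
  exact (twoSignedSource_iff_entropyTradeoff G r).2 (hT G hG r)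

end Summit.QuantumFields.YangMills.Theorems.EntropyBudgetEquipartition.GibbsDuality

end
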